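import Summits.ABC.IUTFork.Cor312LicenceTameDichotomyExact
import HarnessLib

/-!
# [IUTchIII] Cor. 3.12 — at ALL-TAME data the (xi-f) LICENCE itself is an explicit integer predicate:
# `Licence ↔ ∀ bad w | p, ∀ labels j: e_p·((m_Θ(j,w)−1) div e_p) + 1 − j·(e_p−1) ≤ m_q(w)`

PROOF-ONLY support piece (D-0012; 0 definitions, 0 `Prop` facts) of the abc-iut cell (WAVE-4 D-0067 cone-interior prover
abc-iut-w4-d006, gen 5; row «EXPLICIT-DEPTH-STAR», part 4 — licence-level form of part 3's per-packet dichotomy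
`qRegion_subset_thetaHull_settingDHVolSharp_iff_of_tame_orders`). TAKES NO SIDE on [IUTchIII] Cor. 3.12 (S. Mochizuki,
*Inter-universal Teichmüller theory III*, kurims manuscript, Cor. 3.12 p. 173 l. 41 – p. 174 l. 19; Step (xi-f) p. 184 l. 26–29) or on
any author: statements about OUR typed objects (abc-iut-c312-5's `logShellsDH`, abc-iut-c312-3's sharp idele boxes, the assembled real
settings `settingDHVolSharp` / `settingPrVolSharp`); the hull-level licence (abc-iut-c312-1 `Thm311ToCor312.Licence`) is a
STRONGER-THAN-PRINT form of the disputed step (plan DIGEST A 11:12:59Z: «the one clause the derivation needs … typed more strongly than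
print at exactly one place»); nothing here bears on the printed GLOBAL inequality. typed ≠ proved; instantiated ≠ endorsed.

WHAT IS PROVED (namespace `Summit.ABC.IUTFork.Thm311.Real`): **`licence_settingDHVolSharp_iff_of_tame_orders`** and
**`licence_settingPrVolSharp_iff_of_tame_orders`**. Θ-ideles units off `S`; at every prime `p` UNDER `S` a uniformly TAME fibre
(`p > 2`, every `x | p` with `e(x|p) = e_p ≤ p − 2`, uniformizers `ϖ_x`); at every BAD place `w | p` and label `j = i+1 ∈ 𝔽_l^⋇` integer
exponents `‖t_{Θ,j,w}‖ = ‖ϖ_w‖^{m_Θ(j,w)}`, `‖t_{q,w}‖ = ‖ϖ_w‖^{m_q(w)}`, `m_Θ(j,w) ≥ 1`. THEN the licence — the `hLic` binder of branch C's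
leanest certificate `abc_of_licence_v5K` (abc-iut-C-cert-1 p435505) at these settings — holds **iff**
`e_p·((m_Θ(j,w) − 1) div e_p) + 1 − j·(e_p − 1) ≤ m_q(w)` at every bad place and every label. (←) = abc-iut-w5-d180's
`licence_settingDHVolSharp_of_tame_orders` (p440550, movers on all `j+1` capsule slots); (→) = part 3's packet-level refutation
`not_qRegion_subset_thetaHull_settingDHVolSharp_of_tame_star` (STAR form of [IUTchIV] Prop. 1.1/1.2 (ii): only `d_{I∖{*}}` charged) at the
offending packet. For REALISING ideles `m_Θ(j,w) = j²·m_q(w)`, `m_q(w) = ord_w(q_w)/(2l)` (Dupuy–Hilado (3.4)): at all-tame data the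
licence is the arithmetic predicate `∀ w ∈ S, ∀ j ≤ ℓ⋇: e·((j²·m_q(w) − 1) div e) + 1 − j(e−1) ≤ m_q(w)` of the q-depths and the indices
(`j = 1` always satisfied; for `j ≥ 2` roughly `(j−1)·m_q(w) ≤ e − 1`: heavy ramification relative to depth).
HONEST SCOPE: OUR sharp containers (Θ-regions constant in `m`), Dupuy–Hilado's typed (Ind1)/(Ind2) acting independently on every
(capsule slot, place) as abc-iut-c312-1 typed Thm. 3.11 (i); refuted-as-typed ≠ refuted-in-print; nothing about the author's intended hull,
the M-level `Ism`, or the printed GLOBAL inequality; WILD / dyadic bad places are outside this file. [cite: Mochizuki2012, IUTchIV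
Prop. 1.1 p. 9, Prop. 1.2 (i)(ii) p. 10] [cite: DupuyHilado2025, §3.4, §3.9, §4.7, §4.9] [cite: WeilBNT1967, Ch. II §2, Th. 1]
[cite: ScholzeStix2018, §2.2 pp. 9–10] [claim: Mochizuki2012, status: disputed] for every IUT sentence quoted.
-/

noncomputable section

open Set Function
open scoped Pointwise

namespace Summit.ABC.IUTFork.Thm311.Real

open Cor312 Cor312.Setting Cor312Vol Cor312Vol.ExplicitDepth Literature.IUT.LogThetaLattice Literature.IUT.LogVolume
  NumberField IsDedekindDomain
open Literature.NumberTheory.NumberFields Literature.NumberTheory.GaloisRepresentations.Ultrametric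

variable {F : Type} [Field F] [NumberField F] (X : PilotData F) {logv : PadicLogs F} (hlog : LogvAnalytic logv)
  (M : Type) [Field M] [NumberField M]
  (archPk : ∀ (j : (thetaIndex X).Label) (vQ : (thetaIndex X).VQ), Set ((logShellsDH X logv).Packet j vQ))
  (archSub : ∀ (j : (thetaIndex X).Label) (v : (thetaIndex X).V),
    Set ((logShellsDH X logv).Packet j ((thetaIndex X).over v)))
  (Ψ : ℤ → ∀ v : (thetaIndex X).V, v ∈ (thetaIndex X).Vbad → Set ((logShellsDH X logv).StarPacket v))
  (act : ℤ → ∀ v : (thetaIndex X).V, v ∈ (thetaIndex X).Vbad →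
    (logShellsDH X logv).StarPacket v → Module.End ℚ ((logShellsDH X logv).StarPacket v))
  (Mmod : ℤ → ∀ j : (thetaIndex X).LabelStar, Set ((logShellsDH X logv).GlobalPacket j.1))
  (region : ℤ → ∀ j : (thetaIndex X).LabelStar, FinDivisor M → ∀ vQ : (thetaIndex X).VQ,
    Set ((logShellsDH X logv).Packet j.1 vQ))
  (n : ℤ) {HT : Type} {LogLink : HT → HT → Type} {IsFull : ∀ {s t : HT}, LogLink s t → Prop}
  (lat : LGPGaussianLogThetaLattice LogLink IsFull)
  {Frd : Type} {IsoF : Frd → Frd → Type} {Ob : Frd → Type} {realify : Frd → Frd} {Strip : Type}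
  {IsoS : Strip → Strip → Type} {Mv : ∀ v : (thetaIndex X).V, v ∈ (thetaIndex X).Vbad → Type}
  [∀ v h, Monoid (Mv v h)]
  (sig : GlobalLGPFrobenioidSignature (thetaIndex X).lstar (thetaIndex X).V (· ∈ (thetaIndex X).Vbad)
    Frd IsoF Ob realify Strip IsoS Mv)
  (split : SplittingMonoids Mv) {ObΔ : Type} {N : ∀ v : (thetaIndex X).V, v ∈ (thetaIndex X).Vbad → Type}
  [∀ v h, Monoid (N v h)] (qData : QPilotData ObΔ N)
  (tq : ∀ (pp : Nat.Primes) (x : (thetaIndex X).Fibre (.inr pp)), haveI : Fact (pp : ℕ).Prime := ⟨pp.2⟩; kOf X pp.1 x)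
  (t : ∀ (pp : Nat.Primes) (_ : Fin X.lstar) (x : (thetaIndex X).Fibre (.inr pp)),
    haveI : Fact (pp : ℕ).Prime := ⟨pp.2⟩; kOf X pp.1 x)
  (htq0 : ∀ pp x, tq pp x ≠ 0)
  (htq1 : ∀ (pp : Nat.Primes) (x : (thetaIndex X).Fibre (.inr pp)),
    haveI : Fact (pp : ℕ).Prime := ⟨pp.2⟩; placeOf X pp.1 x ∉ X.S → ‖tq pp x‖ = 1)

/-! ## The (xi-f) LICENCE itself at all-tame data: an explicit integer predicate -/

/-- **THE (xi-f) LICENCE AT `settingDHVolSharp` IS DECIDED AT ALL-TAME DATA.** Θ-ideles units off `S`; at every prime `p` UNDER `S`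
a uniformly TAME fibre (`p > 2`, every `x | p` with `e(x|p) = e_p ≤ p − 2`, uniformizers `ϖ_x`); at every BAD place `w | p` and every
label `j = i+1 ∈ 𝔽_l^⋇` integer exponents with `‖t_{Θ,j,w}‖ = ‖ϖ_w‖^{m_Θ(j,w)}`, `‖t_{q,w}‖ = ‖ϖ_w‖^{m_q(w)}`, `m_Θ(j,w) ≥ 1`. THEN
abc-iut-c312-1's `Thm311ToCor312.Licence` (= the `hLic` binder of branch C's leanest certificate `abc_of_licence_v5K`, abc-iut-C-cert-1
p435505, at this setting) holds **iff** at every bad place and every label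

  `e_p·((m_Θ(j,w) − 1) div e_p) + 1 − j·(e_p − 1) ≤ m_q(w)`.

(←) is abc-iut-w5-d180's `licence_settingDHVolSharp_of_tame_orders` (p440550); (→) is part 3's packet-level refutation at the offending packet. For REALISING
ideles `m_Θ(j,w) = j²·m_q(w)` (Dupuy–Hilado (3.4)), so at all-tame data the licence is the predicate
`∀ w ∈ S, ∀ j ≤ ℓ⋇: e·((j²m_q(w) − 1) div e) + 1 − j(e−1) ≤ m_q(w)` of the depths `m_q(w) = ord_w(q_w)/(2l)` and the indices `e`.
HONEST SCOPE as in the file header: OUR containers, Dupuy–Hilado's typed (Ind1)/(Ind2); STRONGER-THAN-PRINT hull reading; nothing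
about the printed GLOBAL inequality; no side taken. [cite: Mochizuki2012, IUTchIV Prop. 1.1 p. 9, Prop. 1.2 (i)(ii) p. 10]
[cite: DupuyHilado2025, §3.4, §3.9, §4.9] [cite: WeilBNT1967, Ch. II §2, Th. 1] [claim: Mochizuki2012, status: disputed] -/
theorem licence_settingDHVolSharp_iff_of_tame_orders
    (ht1 : ∀ (pp : Nat.Primes) (i : Fin X.lstar) (x : (thetaIndex X).Fibre (.inr pp)),
      haveI : Fact (pp : ℕ).Prime := ⟨pp.2⟩; placeOf X pp.1 x ∉ X.S → ‖t pp i x‖ = 1)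
    (e : Nat.Primes → ℕ)
    (ϖ : ∀ (pp : Nat.Primes) (x : (thetaIndex X).Fibre (.inr pp)), haveI : Fact (pp : ℕ).Prime := ⟨pp.2⟩; (kOf X pp.1 x)ˣ)
    (hfib : ∀ (pp : Nat.Primes) (x : (thetaIndex X).Fibre (.inr pp)),
      haveI : Fact (pp : ℕ).Prime := ⟨pp.2⟩
      (∃ w : (thetaIndex X).Fibre (.inr pp), placeOf X pp.1 w ∈ X.S) →
        2 < (pp : ℕ) ∧ e pp ≤ (pp : ℕ) - 2 ∧ (placeOf X pp.1 x).asIdeal.ramificationIdx ℤ = e pp ∧ IsUniformizer (ϖ pp x))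
    (mΘ : ∀ pp : Nat.Primes, Fin (thetaIndex X).lstar → (thetaIndex X).Fibre (.inr pp) → ℤ)
    (mq : ∀ pp : Nat.Primes, (thetaIndex X).Fibre (.inr pp) → ℤ)
    (hΘ : ∀ (pp : Nat.Primes) (i : Fin (thetaIndex X).lstar) (w : (thetaIndex X).Fibre (.inr pp)),
      haveI : Fact (pp : ℕ).Prime := ⟨pp.2⟩
      placeOf X pp.1 w ∈ X.S → ‖t pp i w‖ = ‖(ϖ pp w : kOf X pp.1 w)‖ ^ mΘ pp i w)
    (hq : ∀ (pp : Nat.Primes) (w : (thetaIndex X).Fibre (.inr pp)),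
      haveI : Fact (pp : ℕ).Prime := ⟨pp.2⟩
      placeOf X pp.1 w ∈ X.S → ‖tq pp w‖ = ‖(ϖ pp w : kOf X pp.1 w)‖ ^ mq pp w)
    (h1 : ∀ (pp : Nat.Primes) (i : Fin (thetaIndex X).lstar) (w : (thetaIndex X).Fibre (.inr pp)),
      haveI : Fact (pp : ℕ).Prime := ⟨pp.2⟩; placeOf X pp.1 w ∈ X.S → 1 ≤ mΘ pp i w) :
    Thm311ToCor312.Licence (settingDHVolSharp X hlog M archPk archSub Ψ act Mmod region n lat sig split qData tq t htq0 htq1) ↔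
      ∀ (pp : Nat.Primes) (i : Fin (thetaIndex X).lstar) (w : (thetaIndex X).Fibre (.inr pp)),
        haveI : Fact (pp : ℕ).Prime := ⟨pp.2⟩; placeOf X pp.1 w ∈ X.S →
          (e pp : ℤ) * ((mΘ pp i w - 1) / e pp) + 1 - ((i : ℕ) + 1 : ℕ) * ((e pp : ℤ) - 1) ≤ mq pp w := by
  constructor
  · -- (→): a bad place violating its window refutes the inclusion at that packet
    intro hL pp i w hw
    haveI hF : Fact (pp : ℕ).Prime := ⟨pp.2⟩
    by_contra hlt
    have hS : ∃ w' : (thetaIndex X).Fibre (.inr pp), placeOf X pp.1 w' ∈ X.S := ⟨w, hw⟩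
    obtain ⟨hp2, hep, hram, hunif⟩ := hfib pp w hS
    have hp0 : (0 : ℝ) < (pp : ℕ) := by exact_mod_cast pp.2.pos
    have heK : absRamificationIdx (pp : ℕ) (kOf X pp.1 w) = e pp :=
      (absRamificationIdx_rescaledCompletion F (pp : ℕ) (placeOf X pp.1 w) (natCast_mem_placeOf X pp.1 w)).trans hram
    have hnormϖ : ‖(ϖ pp w : kOf X pp.1 w)‖ = ((pp : ℕ) : ℝ) ^ (-(1 / (e pp : ℝ))) := by
      rw [norm_eq_rpow_of_isUniformizer (pp : ℕ) (kOf X pp.1 w) hunif, heK]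
    have hΘ' : ‖t pp i w‖ = ((pp : ℕ) : ℝ) ^ (-((mΘ pp i w : ℝ) / absRamificationIdx (pp : ℕ) (kOf X pp.1 w))) := by
      rw [hΘ pp i w hw, hnormϖ, ← Real.rpow_intCast, ← Real.rpow_mul hp0.le, heK]
      congr 1
      ring
    have hq' : ‖tq pp w‖ = ((pp : ℕ) : ℝ) ^ (-((mq pp w : ℝ) / absRamificationIdx (pp : ℕ) (kOf X pp.1 w))) := by
      rw [hq pp w hw, hnormϖ, ← Real.rpow_intCast, ← Real.rpow_mul hp0.le, heK]
      congr 1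
      ring
    have hew : absRamificationIdx (pp : ℕ) (kOf X pp.1 w) ≤ (pp : ℕ) - 2 := heK.le.trans hep
    have hdeep : mq pp w + ((i : ℤ) + 1) * ((absRamificationIdx (pp : ℕ) (kOf X pp.1 w) : ℤ) - 1) ≤
        (absRamificationIdx (pp : ℕ) (kOf X pp.1 w) : ℤ) *
          ((mΘ pp i w - 1) / (absRamificationIdx (pp : ℕ) (kOf X pp.1 w) : ℤ)) := by
      rw [heK]
      exact (tame_star_threshold_iff (e pp : ℤ) ((i : ℤ) + 1) (mΘ pp i w) (mq pp w)).2 (by push_cast at hlt ⊢; exact hlt)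
    exact not_qRegion_subset_thetaHull_settingDHVolSharp_of_tame_star X hlog M archPk archSub Ψ act Mmod region n lat sig split
      qData tq t htq0 htq1 pp i w hp2 hew (mΘ pp i w) (mq pp w) hΘ' hq' hdeep (hL i (.inr pp))
  · -- (←): abc-iut-w5-d180's licence theorem in orders
    intro hall
    exact licence_settingDHVolSharp_of_tame_orders X hlog M archPk archSub Ψ act Mmod region n lat sig split qData tq t htq0 htq1
      ht1 e ϖ hfib fun pp i w hw => Or.inr ⟨mΘ pp i w, mq pp w, hΘ pp i w hw, hq pp w hw, h1 pp i w hw, hall pp i w hw⟩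

/-- **The same at the PRINT-NORMALISED setting `settingPrVolSharp`** (branch C's setting; `licence_settingPrVolSharp_iff_settingDHVolSharp`).
[claim: Mochizuki2012, status: disputed] -/
theorem licence_settingPrVolSharp_iff_of_tame_orders
    (ht1 : ∀ (pp : Nat.Primes) (i : Fin X.lstar) (x : (thetaIndex X).Fibre (.inr pp)),
      haveI : Fact (pp : ℕ).Prime := ⟨pp.2⟩; placeOf X pp.1 x ∉ X.S → ‖t pp i x‖ = 1)
    (e : Nat.Primes → ℕ)
    (ϖ : ∀ (pp : Nat.Primes) (x : (thetaIndex X).Fibre (.inr pp)), haveI : Fact (pp : ℕ).Prime := ⟨pp.2⟩; (kOf X pp.1 x)ˣ)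
    (hfib : ∀ (pp : Nat.Primes) (x : (thetaIndex X).Fibre (.inr pp)),
      haveI : Fact (pp : ℕ).Prime := ⟨pp.2⟩
      (∃ w : (thetaIndex X).Fibre (.inr pp), placeOf X pp.1 w ∈ X.S) →
        2 < (pp : ℕ) ∧ e pp ≤ (pp : ℕ) - 2 ∧ (placeOf X pp.1 x).asIdeal.ramificationIdx ℤ = e pp ∧ IsUniformizer (ϖ pp x))
    (mΘ : ∀ pp : Nat.Primes, Fin (thetaIndex X).lstar → (thetaIndex X).Fibre (.inr pp) → ℤ)
    (mq : ∀ pp : Nat.Primes, (thetaIndex X).Fibre (.inr pp) → ℤ)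
    (hΘ : ∀ (pp : Nat.Primes) (i : Fin (thetaIndex X).lstar) (w : (thetaIndex X).Fibre (.inr pp)),
      haveI : Fact (pp : ℕ).Prime := ⟨pp.2⟩
      placeOf X pp.1 w ∈ X.S → ‖t pp i w‖ = ‖(ϖ pp w : kOf X pp.1 w)‖ ^ mΘ pp i w)
    (hq : ∀ (pp : Nat.Primes) (w : (thetaIndex X).Fibre (.inr pp)),
      haveI : Fact (pp : ℕ).Prime := ⟨pp.2⟩
      placeOf X pp.1 w ∈ X.S → ‖tq pp w‖ = ‖(ϖ pp w : kOf X pp.1 w)‖ ^ mq pp w)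
    (h1 : ∀ (pp : Nat.Primes) (i : Fin (thetaIndex X).lstar) (w : (thetaIndex X).Fibre (.inr pp)),
      haveI : Fact (pp : ℕ).Prime := ⟨pp.2⟩; placeOf X pp.1 w ∈ X.S → 1 ≤ mΘ pp i w) :
    Thm311ToCor312.Licence (settingPrVolSharp X hlog M archPk archSub Ψ act Mmod region n lat sig split qData tq t htq0 htq1) ↔
      ∀ (pp : Nat.Primes) (i : Fin (thetaIndex X).lstar) (w : (thetaIndex X).Fibre (.inr pp)),
        haveI : Fact (pp : ℕ).Prime := ⟨pp.2⟩; placeOf X pp.1 w ∈ X.S →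
          (e pp : ℤ) * ((mΘ pp i w - 1) / e pp) + 1 - ((i : ℕ) + 1 : ℕ) * ((e pp : ℤ) - 1) ≤ mq pp w := by
  rw [licence_settingPrVolSharp_iff_settingDHVolSharp]
  exact licence_settingDHVolSharp_iff_of_tame_orders X hlog M archPk archSub Ψ act Mmod region n lat sig split qData tq t htq0 htq1
    ht1 e ϖ hfib mΘ mq hΘ hq h1

end Summit.ABC.IUTFork.Thm311.Real

end
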